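import Summits.QuantumFields.YangMills.Theorems.BalabanUVNodesN24AtThm1CCMWDoorOfStepTokensSignFreeAllTorus
import Summits.QuantumFields.YangMills.Theorems.BalabanUVNodesK0SignFreeOfStepTokensRCube

/-!
# NODE N24 (B2) IN CLOSING POSITION: K1⁷'s θ-KEYED CONSEQUENT (and the registered rung-1 body) AT A FAMILY `F` FROM EXACTLY plan g77's V18 STUB TEXTS READ AT `F`
# — stub 1 ([15] Prop. 8's top step), stub 2 ([6] Prop. 6 at NODE 00's member), stub 3ᴬ (the sign-free |β| box at θ₁₅ᶜᶜᴹ(3)) — AND ONE CHILDREN-UNIFORM HYPOTHESIS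
# (the leaves of N05–N13 and the world binding at the V18 witness `θ₁₅ᶜᶜᴹᵂ(3; γ; ε₀, ε₂₉; B₃, B₃', a₀, a₁')`, UNIFORMLY in the stub ∕ window letters)

TRACK A (YM-PLAN §2d, node N24 of 28 = binder B2 `hB : B16.EndStatementBPrinted D.C`), seat `pub-ymgap-dag-n24-c` (R134 fan-out seat, strategy s2; gen 8, Part 17).  Key of record: K1⁷
`StabilityBAtRecordR13SepCoPH` = stmt-QuantumFields-20542 (`∀ F, (∃ θ, Provisos₁₃SepCoPH ∧ guard ∧ Admissible) → ∃ (θ, h), guard ∧ Admissible ∧ EndStatementBPrinted (datum θ h).C ∧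
∃ γ₁ > 0, ∀ γ ∈ ]0, γ₁], ∃ P, 1 ≤ P.K ∧ flow.InInterval γ P.K`); this file `--supports` it as a helper (Summits lane).
WHY.  Parts 14∕15∕16 (`…SignFreeAllTorus…`, the V18-faithful door: sign-free, all-torus) display the K0 side as the three stubs' BODIES at given letters and the children as pointed
leaves at the witness those letters name.  But the letters COME OUT OF the stubs' existentials (`B₃, a₀, a₁` from stub 1; `B₁, c₁` from stub 2; `γ₀, ε₀, ε₂₉, β′` from stub 3ᴬ, then
`(γ, bₗ, β′)` from ONE window-shrinking), so a child's delivery at the witness is usable by a K1⁷ closer only if it holds UNIFORMLY on the admissible range of those letters.  THIS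
FILE states that closing shape once, in kernel form: from `h1F ∕ h2F ∕ h3AF` (the stub texts at `F`, as spelled in dag-n21-c Cʷ″ `record13SepCoPHBody_of_stubs123A`) and ONE hypothesis
`hchildren` — «∀ admissible stub letters, ∀ witness letters `B₃' ≥ b9Of·B₃`, `0 < a₁' ≤ min a₁ (a0Of∕B₃)`, ∀ window∕box letters with the sign-free box, ∃ residual layers, a world
S-bound to the H-pinned four-pin view, every child leaf (N05–N13, `h09T`, `hK`) and the world's β-box» — K1⁷'s consequent at `F` follows (§1), and so does the registered rung-1
body (§2).  Proof = open the ∃-stubs, `B₃' := b9Of·B₃`, `a₁' := min a₁ (a0Of∕B₃)` (`le_rfl`), (8) by dag-n07-e's bridge, the R (9)-step by FILE C's cube, 3ᴬ at these letters, ONE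
window-shrinking by Cʷ′ `windowLettersBox_of_absBetaBox`, specialise `hchildren`, apply Part 15.  The compound witness letters live in the PROOF only (Part 10's typing note).
So «WHICH CHILD BLOCKS K1⁷», closing form: the three print stubs (N07 ∕ N05 ∕ NODE O–N26) and, per child lane, ONE uniform delivery at the V18 witness family — N05 `B8LeafOfRecordSubBH`,
N06 `B9LeafX (Y9OfRecord …)`, N07 `B11Leaf (Z11OfRecord ζ)`, N08 `PrintedUV3V 2 L`, N09 Lemma 4 + `h09T` (located by `B12NodeKnitRecord13SepCoPH` v1.2: covariance + measurability of the
minimiser selection, support∕nesting in `regSetOfRecord`, [B11] ×3), N10 `B13LeafOfRecord`, N11 (S1ᵀ), N12 `B15Leaf (WOfRecord₁₃ …)` + `hK`, N13 (UV₁₃), and the WORLD's β-box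
(`0 < w.b`: NODE O's positive lower bound; upper = the K0 box's `β′`).
A NEW importing module (imports Part 15 + Cʷ′).  THEOREMS ONLY, def-free, sorry-free, standard axioms.

WHAT THIS FILE PROVES (2 theorems): §1 `N24_stabilityBR13SepCoPH_consequent_of_stubs123A_of_childrenUniform` (K1⁷'s consequent at `F`); §2
`N24_nodesAtSomeRecordS13PWS_of_stubs123A_of_childrenUniform` (the registered rung-1 body `NodesAtSomeRecord13PWS F`'s text at `N = 2`).

HONEST FRAMING: composition BY NAME; nothing of Bałaban's asserted — the three stub texts and the children-uniform hypothesis are DISPLAYED; K0⁷ ∕ K1⁷ NOT closed; N24 COMPOSITE — no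
discharge, no count moved (5∕27), no stub closed; one finite T⁴ programme at fixed ε; NOT continuum ∕ ℝ⁴ ∕ OS ∕ mass gap ∕ Clay.
-/

noncomputable section

open scoped Matrix.Norms.L2Operator

namespace Summit.QuantumFields.YangMills.BalabanUVNodes.N24K1ConsequentOfStubsAndChildren

open Literature.MathematicalPhysics.QuantumFieldTheory.Balaban1983to89
open Literature.MathematicalPhysics.QuantumFieldTheory.Balaban1983to89.Node00
open DagBinding T4Continuum T4DatumAssembly FlowStepRuns AveragingRT
open FlowStep (BetaLowerH BetaUpperH)
open Summit.QuantumFields.YangMills.BalabanUVNodes.N07Thm1Top7FromProp8 (variationalThm1RegSepCoP7M_of_prop8TopStep)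
open Summit.QuantumFields.YangMills.Theorems.K0ROfStepTokensRCube (shrunkCeiling_pos gauge9R_cube_of_prop8TopStep_of_prop6Member)
open Summit.QuantumFields.YangMills.Theorems.K0SignFreeOfStepTokensRCube (windowLettersBox_of_absBetaBox)
open Summit.QuantumFields.YangMills.BalabanUVNodes.N24AtThm1CCMWDoorOfStepTokensSignFreeAllTorus

variable {F : T4Family}

/-! ## §1–§2. `N = 2`, `j = 3`: K1⁷'s consequent and the rung-1 body at `F` from the three stub texts at `F` and the children-uniform hypothesis -/

/-- **★★★ K1⁷'s θ-KEYED CONSEQUENT AT THE FAMILY `F` FROM EXACTLY V18's THREE STUB TEXTS AT `F` AND ONE CHILDREN-UNIFORM HYPOTHESIS** — the closing shape of N24 (B2) on the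
pointed road: `h1F` ∕ `h2F` ∕ `h3AF` are the bodies of plan g77's registered stubs `stub_prop8StepCoP13` ∕ `stub_prop6MemberB8At13` ∕ `stub_absBetaBoxAtThm1WitnessCCM13` READ AT `F`
(texts as spelled in dag-n21-c Cʷ″ `record13SepCoPHBody_of_stubs123A`); `hchildren` says: for EVERY admissible tuple of stub letters `(B₃, a₀, a₁, B₁, c₁)`, witness letters
`B₃' ≥ b9Of·B₃`, `0 < a₁' ≤ min a₁ (a0Of∕B₃)` and window∕box letters `(γ, ε₀, ε₂₉, bₗ, β′)` with the sign-free box of `β₁₃(θ₁₅ᶜᶜᴹ(3;…))` on `]0,γ]`, the children deliver — at the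
V18 witness `θ₁₅ᶜᶜᴹᵂ(3; γ; ε₀, ε₂₉; B₃, B₃', a₀, a₁')` — residual layers `lam8 lam12 lam13 Mstar ops ζ lamW`, a world `w` S-bound to the H-pinned four-pin view, the leaves of
N05 ∕ N06 ∕ N07 ∕ N08 ∕ N09 (+ `h09T`) ∕ N10 ∕ N11 (S1ᵀ) ∕ N12 (+ `hK`) ∕ N13 (UV₁₃) and the WORLD's β-box pair `hlo ∕ hhi` (`0 < w.b`: NODE O).  PROOF: open the two ∃-stubs,
take `B₃' := b9Of·B₃`, `a₁' := min a₁ (a0Of∕B₃)` (`le_rfl`), feed 3ᴬ at these letters with (8) (dag-n07-e's bridge) and the R (9)-step (FILE C's cube), shrink its window ONCE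
(Cʷ′ `windowLettersBox_of_absBetaBox`), specialise `hchildren`, apply Part 15's `…thetaShape20_pinX3HS_…_allTorus_door`.  So K1⁷ (stmt-QuantumFields-20542)'s consequent at `F`
= THIS THEOREM ∘ (stubs 1∕2∕3ᴬ as theorems) ∘ (one children-uniform theorem per child lane); its antecedent `∃ θ, Provisos ∧ …` is not used on this road.
COMPOSITE and CONDITIONAL: every hypothesis displayed; nothing of Bałaban asserted; K0⁷ ∕ K1⁷ NOT closed; no count moved.
[cite: Balaban1989LargeFieldII, Thm 1 p.355, (0.1) pp.355–356, p.391; Balaban1988Convergent, Thm 1 p.262, (3.16)–(3.23) pp.268–270; Balaban1987RG1, Thm 1 p.255, Thm 3 p.264, (0.17)–(0.20) pp.255–256, (1.20)–(1.22) p.264, §1 p.264; Balaban1985Variational, Thm 1 (8)–(9) p.279, Prop. 8 p.304; Balaban1985RegularSpaces, Prop. 6 p.99, Thm 8 (1.146) p.101; Balaban1985UV3, Thm 1 p.257; Balaban1988RG2Cluster, Lemmas 1–3 pp.9–20 (bookkeeping)] -/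
theorem N24_stabilityBR13SepCoPH_consequent_of_stubs123A_of_childrenUniform
    (h1F : ∃ B₃ a₀ a₁ : ℝ, 2 * (F.L : ℝ) ^ 2 ≤ B₃ ∧ 0 < a₀ ∧ 0 < a₁ ∧
      Prop8RegSepTopStep F 2 (fun ν K Ω => suppDomOfRecord F ν K Ω) B₃ a₀ a₁)
    (h2F : ∃ B₁ c₁ : ℝ, 0 ≤ B₁ ∧ 0 < c₁ ∧
      (letI : CStarAlgebra (MatA 2) := {}; B8.Prop6Printed 4 (F.L : ℝ) B₁ c₁ (fun i : B8LeafModelZd.ZdIdx 4 F.L => zdCub (MatA 2) F.L i)))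
    (h3AF : ∀ B₃ B₃' a₀ a₁ : ℝ, 2 * (F.L : ℝ) ^ 2 ≤ B₃ → 0 < B₃' → 0 < a₀ → 0 < a₁ →
      VariationalThm1RegSepCoP7M F 2 B₃ a₀ a₁ →
      Gauge9RegSepTopStepR F 2 (fun ν K Ω => suppDomOfRecord F ν K Ω) (F.L ^ 3) ((11 * 4 + 3 * F.L) * F.L) B₃ B₃' a₀ a₁ →
      ∃ γ₀ ε₀ ε₂₉ β' : ℝ, 0 < γ₀ ∧ 0 < ε₀ ∧ 0 < ε₂₉ ∧
        BetaLowerH (-β') γ₀ (betaOfRecord₁₃ F 2 (theta13OfThm1CCM F 2 3 ε₀ ε₂₉ B₃ B₃' a₀ a₁)) ∧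
        BetaUpperH β' γ₀ (betaOfRecord₁₃ F 2 (theta13OfThm1CCM F 2 3 ε₀ ε₂₉ B₃ B₃' a₀ a₁)))
    (hchildren : ∀ {B₃ a₀ a₁ B₁ c₁ B₃' a₁' : ℝ} (hB₃ : 2 * (F.L : ℝ) ^ 2 ≤ B₃) (ha₀ : 0 < a₀) (h8 : Prop8RegSepTopStep F 2 (fun ν K Ω => suppDomOfRecord F ν K Ω) B₃ a₀ a₁) (hB₁ : 0 ≤ B₁) (hc₁ : 0 < c₁) (hP6 : letI : CStarAlgebra (MatA 2) := {}; B8.Prop6Printed 4 (F.L : ℝ) B₁ c₁ (fun i : B8LeafModelZd.ZdIdx 4 F.L => zdCub (MatA 2) F.L i)) (hB₉ : b9Of F (F.L ^ 3) B₁ * B₃ ≤ B₃') (ha₁' : 0 < a₁') (ha₁'le : a₁' ≤ min a₁ (a0Of F 2 (F.L ^ 3) B₁ c₁ / B₃)) {γ ε₀ ε₂₉ : ℝ} (hγ₀ : 0 < γ) (hγh : γ ≤ 1 / 2) (hε : 0 < ε₀) (hε' : 0 < ε₂₉) {bl β' : ℝ} (hbox : BetaLowerH bl γ (betaOfRecord₁₃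 F 2 (theta13OfThm1CCM F 2 3 ε₀ ε₂₉ B₃ B₃' a₀ a₁'))) (hbox' : BetaUpperH β' γ (betaOfRecord₁₃ F 2 (theta13OfThm1CCM F 2 3 ε₀ ε₂₉ B₃ B₃' a₀ a₁'))) (hl : -bl * γ ^ 2 ≤ 3) (hβ' : β' * γ ^ 2 ≤ 3 / 4),
      ∃ (lam8 : ResidB8 (theta13OfThm1CCMW F 2 3 γ ε₀ ε₂₉ B₃ B₃' a₀ a₁').toStage3Params) (lam12 : ResidB12 F 2 (theta13OfThm1CCMW F 2 3 γ ε₀ ε₂₉ B₃ B₃' a₀ a₁').τ9.M) (lam13 : B12.RunParams → ResidB13 (theta13OfThm1CCMW F 2 3 γ ε₀ ε₂₉ B₃ B₃' a₀ a₁').toStage3Params) (Mstar : ℕ) (ops : OpsY 2 (theta13OfThm1CCMW F 2 3 γ ε₀ ε₂₉ B₃ B₃' a₀ a₁').toStage3Params Mstar) (ζ : ResidZ F 2) (lamW : ResidW F 2) (w : WorldP),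
        (w.C = (datumOfRecord₁₃SepCoPH F 2 (Stage13HParams.ofHistoryBlind F 2 ⟨theta13OfThm1CCMW F 2 3 γ ε₀ ε₂₉ B₃ B₃' a₀ a₁', ZrOfRecord₁₃ F 2 (theta13OfThm1CCMW F 2 3 γ ε₀ ε₂₉ B₃ B₃' a₀ a₁')⟩) (N24_provisos₁₃SepCoPH_door_theta13OfThm1CCMW_cube_of_prop8TopStep_of_prop6Member_of_betaBoxSignFree_allTorus F hB₃ ha₀ h8 hB₁ hc₁ hP6 hB₉ ha₁' ha₁'le hγ₀ hγh hε hε' hbox hbox' hl hβ')).C) ∧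
        (0 < w.γ ∧ w.γ ≤ (theta13OfThm1CCMW F 2 3 γ ε₀ ε₂₉ B₃ B₃' a₀ a₁').γ) ∧
        (w.L = ((theta13OfThm1CCMW F 2 3 γ ε₀ ε₂₉ B₃ B₃' a₀ a₁').L : ℝ)) ∧
        (∀ P, w.up P = upOfRecord₅CS F 2 (((Stage13HParams.ofHistoryBlind F 2 ⟨theta13OfThm1CCMW F 2 3 γ ε₀ ε₂₉ B₃ B₃' a₀ a₁', ZrOfRecord₁₃ F 2 (theta13OfThm1CCMW F 2 3 γ ε₀ ε₂₉ B₃ B₃' a₀ a₁')⟩).pinX3H F 2 lam8 lam12 lam13).view₁₃CoPHB10YZW F 2 Mstar ops ζ lamW) P) ∧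
        (B8LeafOfRecordSubBH (theta13OfThm1CCMW F 2 3 γ ε₀ ε₂₉ B₃ B₃' a₀ a₁').toStage3Params lam8) ∧
        (B9LeafX (Y9OfRecord 2 (theta13OfThm1CCMW F 2 3 γ ε₀ ε₂₉ B₃ B₃' a₀ a₁').toStage3Params Mstar ops)) ∧
        (B11Leaf (Z11OfRecord F 2 ζ)) ∧
        (PrintedUV3V 2 (theta13OfThm1CCMW F 2 3 γ ε₀ ε₂₉ B₃ B₃' a₀ a₁').L) ∧
        (∀ P : B12.RunParams, B12Sec2to5.Lemma4Printed (F12OfRecord₁₂ F 2 (theta13OfThm1CCMW F 2 3 γ ε₀ ε₂₉ B₃ B₃' a₀ a₁').toStage12Params lam12 P) (lam12 P).consts) ∧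
        (∀ P : B12.RunParams, (leavesP w P).smallCouplings → (leavesP w P).smallFieldInductive) ∧
        (∀ P : B12.RunParams, B13LeafOfRecord (theta13OfThm1CCMW F 2 3 γ ε₀ ε₂₉ B₃ B₃' a₀ a₁').toStage3Params (lam13 P)) ∧
        (∀ P : B12.RunParams, (leavesP w P).b7 → (leavesP w P).b8 → (leavesP w P).b9 → (leavesP w P).b10 → (leavesP w P).b11 →
      (leavesP w P).smallCouplings → (leavesP w P).smallFieldInductive → (leavesP w P).flowControl →
        ∀ k, k < P.K → SLaw₁₃CoPH F 2 (Stage13HParams.ofHistoryBlind F 2 ⟨theta13OfThm1CCMW F 2 3 γ ε₀ ε₂₉ B₃ B₃' a₀ a₁', ZrOfRecord₁₃ F 2 (theta13OfThm1CCMW F 2 3 γ ε₀ ε₂₉ B₃ B₃' a₀ a₁')⟩) P k → TLaw₁₃CoPH F 2 (Stage13HParams.ofHistoryBlind F 2 ⟨theta13OfThm1CCMW F 2 3 γ ε₀ ε₂₉ B₃ B₃' a₀ a₁', ZrOfRecord₁₃ F 2 (theta13OfThm1CCMW F 2 3 γ ε₀ ε₂₉ B₃ B₃' a₀ a₁')⟩)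 P k) ∧
        (∀ P : B12.RunParams, B15Leaf (WOfRecord₁₃ F 2 (theta13OfThm1CCMW F 2 3 γ ε₀ ε₂₉ B₃ B₃' a₀ a₁') lamW P)) ∧
        (∀ P : B12.RunParams, (genFlow (betaOfRecord₁₃ F 2 (theta13OfThm1CCMW F 2 3 γ ε₀ ε₂₉ B₃ B₃' a₀ a₁')) P.g0).InInterval w.γ P.K → ∀ k, k ≤ P.K → SLaw₁₃CoPH F 2 (Stage13HParams.ofHistoryBlind F 2 ⟨theta13OfThm1CCMW F 2 3 γ ε₀ ε₂₉ B₃ B₃' a₀ a₁', ZrOfRecord₁₃ F 2 (theta13OfThm1CCMW F 2 3 γ ε₀ ε₂₉ B₃ B₃' a₀ a₁')⟩) P k →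
      ∀ U : GaugeField (F.P P.K) k (SU 2),
        chiβOfRecord₁₃ F 2 (theta13OfThm1CCMW F 2 3 γ ε₀ ε₂₉ B₃ B₃' a₀ a₁') P.K (gOfRecord₁₃ F 2 (theta13OfThm1CCMW F 2 3 γ ε₀ ε₂₉ B₃ B₃' a₀ a₁') P) k U *
              Real.exp (-(1 / (gOfRecord₁₃ F 2 (theta13OfThm1CCMW F 2 3 γ ε₀ ε₂₉ B₃ B₃' a₀ a₁') P k) ^ 2 * wilsonBGOfRecord F 2 (theta13OfThm1CCMW F 2 3 γ ε₀ ε₂₉ B₃ B₃' a₀ a₁').εbg P k U)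
                - w.em (gOfRecord₁₃ F 2 (theta13OfThm1CCMW F 2 3 γ ε₀ ε₂₉ B₃ B₃' a₀ a₁') P k) * (Fintype.card (Site (F.P P.K) k) : ℝ)) ≤ densOfRecord₁₃ F 2 (theta13OfThm1CCMW F 2 3 γ ε₀ ε₂₉ B₃ B₃' a₀ a₁') P k U ∧
        densOfRecord₁₃ F 2 (theta13OfThm1CCMW F 2 3 γ ε₀ ε₂₉ B₃ B₃' a₀ a₁') P k U ≤ Real.exp (w.ep (gOfRecord₁₃ F 2 (theta13OfThm1CCMW F 2 3 γ ε₀ ε₂₉ B₃ B₃' a₀ a₁') P k) * (Fintype.card (Site (F.P P.K) k) : ℝ))) ∧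
        (BetaLowerH w.b w.γ (betaOfRecord₁₃ F 2 (theta13OfThm1CCMW F 2 3 γ ε₀ ε₂₉ B₃ B₃' a₀ a₁'))) ∧
        (BetaUpperH w.βup w.γ (betaOfRecord₁₃ F 2 (theta13OfThm1CCMW F 2 3 γ ε₀ ε₂₉ B₃ B₃' a₀ a₁')))) :
    ∃ (θ' : Stage13HParams F 2) (h' : θ'.Provisos₁₃SepCoPH F 2), (θ'.ZhUnity F 2 ∧ θ'.SlotsNondegenerate₁₃ F 2) ∧ θ'.Admissible F 2 ∧
      B16.EndStatementBPrinted (datumOfRecord₁₃SepCoPH F 2 θ' h').C ∧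
      ∃ γ₁ : ℝ, 0 < γ₁ ∧ ∀ γ : ℝ, 0 < γ → γ ≤ γ₁ → ∃ P : B12.RunParams, 1 ≤ P.K ∧ ((datumOfRecord₁₃SepCoPH F 2 θ' h').C P).flow.InInterval γ P.K := by
  obtain ⟨B₃, a₀, a₁, hB₃, ha₀, ha₁, h8⟩ := h1F
  obtain ⟨B₁, c₁, hB₁, hc₁, hP6⟩ := h2F
  have hL0 : (0 : ℝ) < (F.L : ℝ) := by exact_mod_cast lt_trans Nat.zero_lt_one F.hL.2
  have hBpos : (0 : ℝ) < B₃ := lt_of_lt_of_le (mul_pos two_pos (pow_pos hL0 2)) hB₃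
  have ha₁' : 0 < min a₁ (a0Of F 2 (F.L ^ 3) B₁ c₁ / B₃) := shrunkCeiling_pos F (F.L ^ 3) hBpos hB₁ hc₁ ha₁
  have hB9 : 0 < b9Of F (F.L ^ 3) B₁ * B₃ := mul_pos (b9Of_pos (F := F) (F.L ^ 3) hB₁) hBpos
  obtain ⟨γ, ε₀, ε₂₉, bl, β', hγ0, hγh, hε, hε', hl, hu, hlow, hup⟩ :=
    windowLettersBox_of_absBetaBox F h3AF B₃ (b9Of F (F.L ^ 3) B₁ * B₃) a₀ (min a₁ (a0Of F 2 (F.L ^ 3) B₁ c₁ / B₃)) hB₃ hB9 ha₀ ha₁'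
      (variationalThm1RegSepCoP7M_of_prop8TopStep hBpos (h8.of_le le_rfl (min_le_left _ _)))
      (gauge9R_cube_of_prop8TopStep_of_prop6Member F hBpos h8 hB₁ hc₁ hP6)
  obtain ⟨lam8, lam12, lam13, Mstar, ops, ζ, lamW, w, hC, hγ, hL, hup', h05, h06, h07, h08, h09, h09T, h10, h11, h12, hUV, hlo, hhi⟩ :=
    hchildren hB₃ ha₀ h8 hB₁ hc₁ hP6 le_rfl ha₁' le_rfl hγ0 hγh hε hε' hlow hup hl hu
  exact N24_stabilityBR13SepCoPH_thetaShape20_pinX3HS_fourPin_pointed_theta13OfThm1CCMW_cube_of_prop8TopStep_of_prop6Member_of_betaBoxSignFree_allTorus_door hB₃ ha₀ h8 hB₁ hc₁ hP6 le_rfl ha₁' le_rfl hγ0 hγh hε hε' hlow hup hl hu lam8 lam12 lam13 Mstar ops ζ lamW w hC hγ hL hup' h05 h06 h07 h08 h09 h09T h10 h11 h12 hUV hlo hhi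

/-- **★★ RUNG 1's BODY (`NodesAtSomeRecord13PWS F`'s text at `N = 2`) AT THE FAMILY `F` FROM EXACTLY V18's THREE STUB TEXTS AT `F` AND ONE CHILDREN-UNIFORM HYPOTHESIS** — the closing shape of N24 (B2) on the
pointed road: `h1F` ∕ `h2F` ∕ `h3AF` are the bodies of plan g77's registered stubs `stub_prop8StepCoP13` ∕ `stub_prop6MemberB8At13` ∕ `stub_absBetaBoxAtThm1WitnessCCM13` READ AT `F`
(texts as spelled in dag-n21-c Cʷ″ `record13SepCoPHBody_of_stubs123A`); `hchildren` says: for EVERY admissible tuple of stub letters `(B₃, a₀, a₁, B₁, c₁)`, witness letters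
`B₃' ≥ b9Of·B₃`, `0 < a₁' ≤ min a₁ (a0Of∕B₃)` and window∕box letters `(γ, ε₀, ε₂₉, bₗ, β′)` with the sign-free box of `β₁₃(θ₁₅ᶜᶜᴹ(3;…))` on `]0,γ]`, the children deliver — at the
V18 witness `θ₁₅ᶜᶜᴹᵂ(3; γ; ε₀, ε₂₉; B₃, B₃', a₀, a₁')` — residual layers `lam8 lam12 lam13 Mstar ops ζ lamW`, a world `w` S-bound to the H-pinned four-pin view, the leaves of
N05 ∕ N06 ∕ N07 ∕ N08 ∕ N09 (+ `h09T`) ∕ N10 ∕ N11 (S1ᵀ) ∕ N12 (+ `hK`) ∕ N13 (UV₁₃) (no β-box: rung 1).  PROOF: open the two ∃-stubs,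
take `B₃' := b9Of·B₃`, `a₁' := min a₁ (a0Of∕B₃)` (`le_rfl`), feed 3ᴬ at these letters with (8) (dag-n07-e's bridge) and the R (9)-step (FILE C's cube), shrink its window ONCE
(Cʷ′ `windowLettersBox_of_absBetaBox`), specialise `hchildren`, apply Part 15's rung-1 `…nodesAtSomeRecordS₁₃SepCoPH_of_pinX3HS_…_allTorus_door`.  So K1⁷'s registered rung-1 body at `F` = THIS THEOREM ∘ (stubs 1∕2∕3ᴬ as theorems) ∘ (one children-uniform theorem per child lane); its antecedent `∃ θ, Provisos ∧ …` is not used on this road.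
COMPOSITE and CONDITIONAL: every hypothesis displayed; nothing of Bałaban asserted; K0⁷ ∕ K1⁷ NOT closed; no count moved.
[cite: Balaban1989LargeFieldII, Thm 1 p.355, (0.1) pp.355–356, p.391; Balaban1988Convergent, Thm 1 p.262, (3.16)–(3.23) pp.268–270; Balaban1987RG1, Thm 1 p.255, Thm 3 p.264, (0.17)–(0.20) pp.255–256, (1.20)–(1.22) p.264, §1 p.264; Balaban1985Variational, Thm 1 (8)–(9) p.279, Prop. 8 p.304; Balaban1985RegularSpaces, Prop. 6 p.99, Thm 8 (1.146) p.101; Balaban1985UV3, Thm 1 p.257; Balaban1988RG2Cluster, Lemmas 1–3 pp.9–20 (bookkeeping)] -/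
theorem N24_nodesAtSomeRecordS13PWS_of_stubs123A_of_childrenUniform
    (h1F : ∃ B₃ a₀ a₁ : ℝ, 2 * (F.L : ℝ) ^ 2 ≤ B₃ ∧ 0 < a₀ ∧ 0 < a₁ ∧
      Prop8RegSepTopStep F 2 (fun ν K Ω => suppDomOfRecord F ν K Ω) B₃ a₀ a₁)
    (h2F : ∃ B₁ c₁ : ℝ, 0 ≤ B₁ ∧ 0 < c₁ ∧
      (letI : CStarAlgebra (MatA 2) := {}; B8.Prop6Printed 4 (F.L : ℝ) B₁ c₁ (fun i : B8LeafModelZd.ZdIdx 4 F.L => zdCub (MatA 2) F.L i)))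
    (h3AF : ∀ B₃ B₃' a₀ a₁ : ℝ, 2 * (F.L : ℝ) ^ 2 ≤ B₃ → 0 < B₃' → 0 < a₀ → 0 < a₁ →
      VariationalThm1RegSepCoP7M F 2 B₃ a₀ a₁ →
      Gauge9RegSepTopStepR F 2 (fun ν K Ω => suppDomOfRecord F ν K Ω) (F.L ^ 3) ((11 * 4 + 3 * F.L) * F.L) B₃ B₃' a₀ a₁ →
      ∃ γ₀ ε₀ ε₂₉ β' : ℝ, 0 < γ₀ ∧ 0 < ε₀ ∧ 0 < ε₂₉ ∧
        BetaLowerH (-β') γ₀ (betaOfRecord₁₃ F 2 (theta13OfThm1CCM F 2 3 ε₀ ε₂₉ B₃ B₃' a₀ a₁)) ∧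
        BetaUpperH β' γ₀ (betaOfRecord₁₃ F 2 (theta13OfThm1CCM F 2 3 ε₀ ε₂₉ B₃ B₃' a₀ a₁)))
    (hchildren : ∀ {B₃ a₀ a₁ B₁ c₁ B₃' a₁' : ℝ} (hB₃ : 2 * (F.L : ℝ) ^ 2 ≤ B₃) (ha₀ : 0 < a₀) (h8 : Prop8RegSepTopStep F 2 (fun ν K Ω => suppDomOfRecord F ν K Ω) B₃ a₀ a₁) (hB₁ : 0 ≤ B₁) (hc₁ : 0 < c₁) (hP6 : letI : CStarAlgebra (MatA 2) := {}; B8.Prop6Printed 4 (F.L : ℝ) B₁ c₁ (fun i : B8LeafModelZd.ZdIdx 4 F.L => zdCub (MatA 2) F.L i)) (hB₉ : b9Of F (F.L ^ 3) B₁ * B₃ ≤ B₃') (ha₁' : 0 < a₁') (ha₁'le : a₁' ≤ min a₁ (a0Of F 2 (F.L ^ 3) B₁ c₁ / B₃)) {γ ε₀ ε₂₉ : ℝ} (hγ₀ : 0 < γ) (hγh : γ ≤ 1 / 2) (hε : 0 < ε₀) (hε' : 0 < ε₂₉) {bl β' : ℝ} (hbox : BetaLowerH bl γ (betaOfRecord₁₃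 F 2 (theta13OfThm1CCM F 2 3 ε₀ ε₂₉ B₃ B₃' a₀ a₁'))) (hbox' : BetaUpperH β' γ (betaOfRecord₁₃ F 2 (theta13OfThm1CCM F 2 3 ε₀ ε₂₉ B₃ B₃' a₀ a₁'))) (hl : -bl * γ ^ 2 ≤ 3) (hβ' : β' * γ ^ 2 ≤ 3 / 4),
      ∃ (lam8 : ResidB8 (theta13OfThm1CCMW F 2 3 γ ε₀ ε₂₉ B₃ B₃' a₀ a₁').toStage3Params) (lam12 : ResidB12 F 2 (theta13OfThm1CCMW F 2 3 γ ε₀ ε₂₉ B₃ B₃' a₀ a₁').τ9.M) (lam13 : B12.RunParams → ResidB13 (theta13OfThm1CCMW F 2 3 γ ε₀ ε₂₉ B₃ B₃' a₀ a₁').toStage3Params) (Mstar : ℕ) (ops : OpsY 2 (theta13OfThm1CCMW F 2 3 γ ε₀ ε₂₉ B₃ B₃' a₀ a₁').toStage3Params Mstar) (ζ : ResidZ F 2) (lamW : ResidW F 2) (w : WorldP),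
        (w.C = (datumOfRecord₁₃SepCoPH F 2 (Stage13HParams.ofHistoryBlind F 2 ⟨theta13OfThm1CCMW F 2 3 γ ε₀ ε₂₉ B₃ B₃' a₀ a₁', ZrOfRecord₁₃ F 2 (theta13OfThm1CCMW F 2 3 γ ε₀ ε₂₉ B₃ B₃' a₀ a₁')⟩) (N24_provisos₁₃SepCoPH_door_theta13OfThm1CCMW_cube_of_prop8TopStep_of_prop6Member_of_betaBoxSignFree_allTorus F hB₃ ha₀ h8 hB₁ hc₁ hP6 hB₉ ha₁' ha₁'le hγ₀ hγh hε hε' hbox hbox' hl hβ')).C) ∧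
        (0 < w.γ ∧ w.γ ≤ (theta13OfThm1CCMW F 2 3 γ ε₀ ε₂₉ B₃ B₃' a₀ a₁').γ) ∧
        (w.L = ((theta13OfThm1CCMW F 2 3 γ ε₀ ε₂₉ B₃ B₃' a₀ a₁').L : ℝ)) ∧
        (∀ P, w.up P = upOfRecord₅CS F 2 (((Stage13HParams.ofHistoryBlind F 2 ⟨theta13OfThm1CCMW F 2 3 γ ε₀ ε₂₉ B₃ B₃' a₀ a₁', ZrOfRecord₁₃ F 2 (theta13OfThm1CCMW F 2 3 γ ε₀ ε₂₉ B₃ B₃' a₀ a₁')⟩).pinX3H F 2 lam8 lam12 lam13).view₁₃CoPHB10YZW F 2 Mstar ops ζ lamW) P) ∧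
        (B8LeafOfRecordSubBH (theta13OfThm1CCMW F 2 3 γ ε₀ ε₂₉ B₃ B₃' a₀ a₁').toStage3Params lam8) ∧
        (B9LeafX (Y9OfRecord 2 (theta13OfThm1CCMW F 2 3 γ ε₀ ε₂₉ B₃ B₃' a₀ a₁').toStage3Params Mstar ops)) ∧
        (B11Leaf (Z11OfRecord F 2 ζ)) ∧
        (PrintedUV3V 2 (theta13OfThm1CCMW F 2 3 γ ε₀ ε₂₉ B₃ B₃' a₀ a₁').L) ∧
        (∀ P : B12.RunParams, B12Sec2to5.Lemma4Printed (F12OfRecord₁₂ F 2 (theta13OfThm1CCMW F 2 3 γ ε₀ ε₂₉ B₃ B₃' a₀ a₁').toStage12Params lam12 P) (lam12 P).consts) ∧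
        (∀ P : B12.RunParams, (leavesP w P).smallCouplings → (leavesP w P).smallFieldInductive) ∧
        (∀ P : B12.RunParams, B13LeafOfRecord (theta13OfThm1CCMW F 2 3 γ ε₀ ε₂₉ B₃ B₃' a₀ a₁').toStage3Params (lam13 P)) ∧
        (∀ P : B12.RunParams, (leavesP w P).b7 → (leavesP w P).b8 → (leavesP w P).b9 → (leavesP w P).b10 → (leavesP w P).b11 →
      (leavesP w P).smallCouplings → (leavesP w P).smallFieldInductive → (leavesP w P).flowControl →
        ∀ k, k < P.K → SLaw₁₃CoPH F 2 (Stage13HParams.ofHistoryBlind F 2 ⟨theta13OfThm1CCMW F 2 3 γ ε₀ ε₂₉ B₃ B₃' a₀ a₁', ZrOfRecord₁₃ F 2 (theta13OfThm1CCMW F 2 3 γ ε₀ ε₂₉ B₃ B₃' a₀ a₁')⟩) P k → TLaw₁₃CoPH F 2 (Stage13HParams.ofHistoryBlind F 2 ⟨theta13OfThm1CCMW F 2 3 γ ε₀ ε₂₉ B₃ B₃' a₀ a₁', ZrOfRecord₁₃ F 2 (theta13OfThm1CCMW F 2 3 γ ε₀ ε₂₉ B₃ B₃' a₀ a₁')⟩)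 P k) ∧
        (∀ P : B12.RunParams, B15Leaf (WOfRecord₁₃ F 2 (theta13OfThm1CCMW F 2 3 γ ε₀ ε₂₉ B₃ B₃' a₀ a₁') lamW P)) ∧
        (∀ P : B12.RunParams, (genFlow (betaOfRecord₁₃ F 2 (theta13OfThm1CCMW F 2 3 γ ε₀ ε₂₉ B₃ B₃' a₀ a₁')) P.g0).InInterval w.γ P.K → ∀ k, k ≤ P.K → SLaw₁₃CoPH F 2 (Stage13HParams.ofHistoryBlind F 2 ⟨theta13OfThm1CCMW F 2 3 γ ε₀ ε₂₉ B₃ B₃' a₀ a₁', ZrOfRecord₁₃ F 2 (theta13OfThm1CCMW F 2 3 γ ε₀ ε₂₉ B₃ B₃' a₀ a₁')⟩) P k →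
      ∀ U : GaugeField (F.P P.K) k (SU 2),
        chiβOfRecord₁₃ F 2 (theta13OfThm1CCMW F 2 3 γ ε₀ ε₂₉ B₃ B₃' a₀ a₁') P.K (gOfRecord₁₃ F 2 (theta13OfThm1CCMW F 2 3 γ ε₀ ε₂₉ B₃ B₃' a₀ a₁') P) k U *
              Real.exp (-(1 / (gOfRecord₁₃ F 2 (theta13OfThm1CCMW F 2 3 γ ε₀ ε₂₉ B₃ B₃' a₀ a₁') P k) ^ 2 * wilsonBGOfRecord F 2 (theta13OfThm1CCMW F 2 3 γ ε₀ ε₂₉ B₃ B₃' a₀ a₁').εbg P k U)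
                - w.em (gOfRecord₁₃ F 2 (theta13OfThm1CCMW F 2 3 γ ε₀ ε₂₉ B₃ B₃' a₀ a₁') P k) * (Fintype.card (Site (F.P P.K) k) : ℝ)) ≤ densOfRecord₁₃ F 2 (theta13OfThm1CCMW F 2 3 γ ε₀ ε₂₉ B₃ B₃' a₀ a₁') P k U ∧
        densOfRecord₁₃ F 2 (theta13OfThm1CCMW F 2 3 γ ε₀ ε₂₉ B₃ B₃' a₀ a₁') P k U ≤ Real.exp (w.ep (gOfRecord₁₃ F 2 (theta13OfThm1CCMW F 2 3 γ ε₀ ε₂₉ B₃ B₃' a₀ a₁') P k) * (Fintype.card (Site (F.P P.K) k) : ℝ))) ∧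
        (∀ P : B12.RunParams, 1 ≤ P.K → lamW.kSel P < P.K)) :
    ∃ (θ : Stage13HParams F 2) (hP : θ.Provisos₁₃SepCoPH F 2) (w : WorldP), (θ.ZhUnity F 2 ∧ θ.SlotsNondegenerate₁₃ F 2) ∧ θ.Admissible F 2 ∧
      (∃ (θ' : Stage13HParams F 2) (h' : θ'.Provisos₁₃SepCoPH F 2), θ'.Admissible F 2 ∧
      datumOfRecord₁₃SepCoPH F 2 θ hP = datumOfRecord₁₃SepCoPH F 2 θ' h' ∧ w.C = (datumOfRecord₁₃SepCoPH F 2 θ hP).C ∧ (0 < w.γ ∧ w.γ ≤ θ'.γ) ∧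
      w.L = (θ'.L : ℝ) ∧ ∀ P : B12.RunParams, w.up P = upOfRecord₅CS F 2 (θ'.toStage5₁₃CoPH F 2) P) ∧
      (∀ P : B12.RunParams, Nodes (leavesP w P)) ∧ PrintedUV3V 2 θ.L ∧
      ∃ lam : ResidW F 2, (∀ P : B12.RunParams, 1 ≤ P.K → lam.kSel P < P.K) ∧
        ∀ P : B12.RunParams, lam.kSel P < P.K → ((leavesP w P).rBasicStep ↔ B15Leaf (WOfRecord₁₃ F 2 θ.toStage13Params lam P)) := by
  obtain ⟨B₃, a₀, a₁, hB₃, ha₀, ha₁, h8⟩ := h1F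
  obtain ⟨B₁, c₁, hB₁, hc₁, hP6⟩ := h2F
  have hL0 : (0 : ℝ) < (F.L : ℝ) := by exact_mod_cast lt_trans Nat.zero_lt_one F.hL.2
  have hBpos : (0 : ℝ) < B₃ := lt_of_lt_of_le (mul_pos two_pos (pow_pos hL0 2)) hB₃
  have ha₁' : 0 < min a₁ (a0Of F 2 (F.L ^ 3) B₁ c₁ / B₃) := shrunkCeiling_pos F (F.L ^ 3) hBpos hB₁ hc₁ ha₁
  have hB9 : 0 < b9Of F (F.L ^ 3) B₁ * B₃ := mul_pos (b9Of_pos (F := F) (F.L ^ 3) hB₁) hBpos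
  obtain ⟨γ, ε₀, ε₂₉, bl, β', hγ0, hγh, hε, hε', hl, hu, hlow, hup⟩ :=
    windowLettersBox_of_absBetaBox F h3AF B₃ (b9Of F (F.L ^ 3) B₁ * B₃) a₀ (min a₁ (a0Of F 2 (F.L ^ 3) B₁ c₁ / B₃)) hB₃ hB9 ha₀ ha₁'
      (variationalThm1RegSepCoP7M_of_prop8TopStep hBpos (h8.of_le le_rfl (min_le_left _ _)))
      (gauge9R_cube_of_prop8TopStep_of_prop6Member F hBpos h8 hB₁ hc₁ hP6)
  obtain ⟨lam8, lam12, lam13, Mstar, ops, ζ, lamW, w, hC, hγ, hL, hup', h05, h06, h07, h08, h09, h09T, h10, h11, h12, hUV, hK⟩ :=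
    hchildren hB₃ ha₀ h8 hB₁ hc₁ hP6 le_rfl ha₁' le_rfl hγ0 hγh hε hε' hlow hup hl hu
  exact N24_nodesAtSomeRecordS₁₃SepCoPH_of_pinX3HS_fourPin_pointed_theta13OfThm1CCMW_cube_of_prop8TopStep_of_prop6Member_of_betaBoxSignFree_allTorus_door hB₃ ha₀ h8 hB₁ hc₁ hP6 le_rfl ha₁' le_rfl hγ0 hγh hε hε' hlow hup hl hu lam8 lam12 lam13 Mstar ops ζ lamW w hC hγ hL hup' h05 h06 h07 h08 h09 h09T h10 h11 h12 hUV hK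

end Summit.QuantumFields.YangMills.BalabanUVNodes.N24K1ConsequentOfStubsAndChildren

end
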